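import Summits.HubbardSuperconductivity.HubbardSuperconductivity.Theses.DeformationLadder
import Summits.HubbardSuperconductivity.HubbardSuperconductivity.Theorems.DeformationLadderLadderThesisFreePoint
import Summits.HubbardSuperconductivity.HubbardSuperconductivity.Theorems.DeformationLadderLadderThesisNormalForms
import Summits.HubbardSuperconductivity.HubbardSuperconductivity.Theorems.DeformationLadderLadderThesisPinnedFrameConverse
import Summits.HubbardSuperconductivity.HubbardSuperconductivity.Theorems.LadderThesis.Negative.FrameAverageCeiling
import HarnessLib

/-!
# Disproof of `LadderThesis` (crux stmt-HubbardSuperconductivity-1890, route DeformationLadder) — findings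

Standing disprover's workfile (cdisprove, cycle 1, 2026-08-16; refuter-cdisprove-stmt-HubbardSuperconductivity-1890-0).
VERDICT OF THE CYCLE: **no kill; none is plausible with present knowledge** — see §E. What IS settled,
as Lean (this file elaborates against the tree; no `sorry`):

* §A LOAD-BEARING HYPOTHESES.
  - `0 < U` is load-bearing: `ladderThesis_false_without_hU` (the matrix at the free point `U = 0` fails for
    every `δ ≥ -1, s, a > 0, L₀`; landed by seat PF as `not_ladderThesisMatrix_at_free_point`, p91441, from the
    sharp Fermi step of every free sector ground state, `CwThesis.Negative.free_pairIntensity_le`).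
  - `0 < a` carries ALL the content: `ladderThesisWithoutPosA_holds` (with `a := 0` the matrix is a theorem:
    penalised sector ground states exist, p88396, and `Δ_dᴴΔ_d ≥ 0`).
  - `∃ s > 0` is cosmetic downward, rigid upward: the matrix is antitone in `s` (`ladderThesisMatrix_anti`,
    `ladderThesis_iff_allSmallPenalties`, p91441) — content at `s → 0⁺` — while upward the floor must decay,
    `a·√s ≤ 32(π²+1)` (`ladderThesis_floor_mul_sqrt_penalty_le`, mine, p99774/file 2).
  - `Even L`, `L₀ ≤ L`, `δ < 1/2`: not attacked in Lean (odd sides / small sides / dense fillings are not where a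
    refutation can live: the statement is `∃ L₀`, and `δ`, `U` are existential).
* §B TIGHTNESS (mine, `Theorems/LadderThesis/Negative/FrameAverage{TwistCost,Ceiling}.lean`): frame-AVERAGED
  Bloch/LSM + Kennedy–Lieb–Shastry ceilings, caveat-free versions of PF's one-frame ceilings (p93488):
  every unit ground state of `H_L + (s/L⁴)Δ_dᴴΔ_d` has `w(0) ≤ 32π²M²/s + 32/(M+1)²` (`M + 1 ≤ L`); every
  instance `(U,δ,κ,a,L₀)` of `LowEnergyRigidity` (≡ the crux, p89166) has `κ·a ≤ 2048π²`
  (`lowEnergyRigidity_window_mul_floor_le`).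
* §C NATURAL STRENGTHENINGS REFUTED: floor uniform in the penalty strength — FALSE
  (`not_ladderThesis_uniform_in_penalty`); rigidity floor uniform in the window — FALSE
  (`not_lowEnergyRigidity_uniform_in_window`).
* §D TARGETS / LINE `Sketch` (card pinned-up-gauge-frame): no live stub. The lead closed `stub_condensateBloch`
  as VACUOUS (p96131, `γ := σ/32`) and declared the line dead (`Lines/Sketch-dead.md`): the remaining stubs are
  `TgLowEnergyCondensation` (open crux stmt-1510 verbatim) and `stub_transfer ≡ (stmt-1510 → stmt-1890)`.
  Neither is refutable here: a refutation of `stub_transfer` needs `TgLowEnergyCondensation ∧ ¬LadderThesis` at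
  the witness `(U,δ)`, i.e. a certified Fulde–Ferrell/PDW-type sector ground state of the pure 2D Hubbard model —
  summit-grade. I concur with the lead's diagnosis; nothing to add to `-- Targets`.
* §E WHY THE CRUX RESISTS (for ideators/planners; numbers, not adjectives):
  1. Normal form (p89166): `LadderThesis ⟺ LowEnergyRigidity ⟺ TwistGap.TgThesis ⟺ penaltyGap`
     (`minE(H+(s/L⁴)P) − minE(H) ≥ a·s` at all large even `L`). With `Φ_L(s) := minE(H+(s/L⁴)P) − minE(H)`
     (concave, `Φ_L(0)=0`, `0 ≤ Φ_L' ≤ 32`): S (the summit at `(U,δ)`) is `liminf_L Φ_L'(0⁺) > 0`, the crux is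
     `∃ s>0: liminf_L Φ_L(s)/s > 0`. So `crux ⟹ S` (Assembly, proved) and `S ∧ ¬crux` at `(U,δ)` forces
     `Φ_L` to bend from slope `≥ a` to slope `≈ 0` within `s ∈ [0, s_L]`, `s_L → 0`: in-sector states with a
     FIXED FRACTION less q=0 d-wave LRO at `o(1)` TOTAL excess energy ("LRO without LRO-stiffness"). In a
     superconductor with phase stiffness `ρ_s > 0` the cheapest such states are phase textures, costing
     `≈ π²ρ_s·A²` total energy for an LRO loss `≈ 2A²·w(0)` — an `O(1)` exchange rate — so the crux holds with
     any `s < π²ρ_s/(2w(0))`-ish. Killing the crux at `(U,δ)` WITHOUT killing S there needs a soft mode that no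
     known mechanism supplies generically; and `(U,δ)` are EXISTENTIAL, so a kill must cover every coupling:
     `¬LadderThesis ⊇ ¬(S with stiffness at any (U,δ))`, the open problem itself (weak-coupling asymptotics —
     Raghu–Kivelson–Scalapino 2010 — predict it TRUE with `a ~ e^{-c/U²}` at small `U`, `δ` away from 0, 1/2).
  2. No printed `T = 0` negative result applies: the catalogued barriers `HohenbergMerminWagnerPairing`,
     `PositiveTemperatureNoPairLRO` (Koma–Tasaki 1992) are `T > 0`; `GeneralizedHartreeFockNoPairing`
     (Bach–Lieb–Solovej) restricts the STATE class, not the model; `StrongCouplingCeiling` /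
     `WeakCouplingCeiling` bound the SIZE of `a(U)` (so any witness has `a` exponentially small at weak coupling
     and `O(t²/U²)`-small at strong coupling) but never make it `0`; `PureModelStripeCompetition` (Qin et al.
     2020, `U=8, δ=1/8, t'=0`) is numerical and pointwise in `(U,δ)`.
  3. Small models: only `L = 2, 4` are exactly diagonalisable (`L = 6`: sector dimension `> 10¹⁷`); at `L ≤ 4`
     the "LRO density" `L⁻⁴Re⟨Δ_dᴴΔ_d⟩` is dominated by its `O(L⁻²)` short-range part (`≤ 320/L²` already for
     the free gas, p91441), so no finite-size computation bears on `∃ L₀ ∀ L ≥ L₀`. None run (by design).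
  4. Junk/vacuity: none — `minEnergyOn` is taken on a nonempty sector (`N_L ≤ L²`), attained (finite dim);
     `IsGroundStateInSector` pins the eigenvalue; `expect`/`⬝ᵥ`/`(L:ℝ)^4` carry no junk at `L ≥ 1`; the matrix
     is neither trivially true (free point fails, §A) nor trivially false (§A, `a := 0` holds).
  Recommendation (concurring with Sketch-dead.md): the refutable member of the equivalence class is the
  UNIVERSAL single-momentum stiffness statement `TwistGap.TgPairMomentumRigidity` (stmt-1509: false at one
  `(U,δ)` by ONE certified finite-momentum condensate); `LadderThesis` itself is only as refutable as S.
* §F `ladderThesis_iff_everyGroundState` — the `∃ φ` / `∀ φ` forms of the crux agree up to `s ↦ s/2`.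
* NOT FORMALISED (recorded for completeness): `L₀` is needed — at `L = 2` the matrix fails for EVERY `U, s`
  (two electrons; Perron–Frobenius in the `(1↑,1↓)` sector makes the unique ground state `D₄`-even while
  `Δ_dᴴ|0⟩` is `B₁`, so `Δ_d ψ = 0` and `ψ` stays the unique ground state of `H + cΔ_dᴴΔ_d`, LRO `0`);
  needs the two-particle PF on the tree's Fock space, low value for provers.
-/

noncomputable section

namespace Summit.HubbardSuperconductivity.HubbardSuperconductivity.Cruxes.LadderThesis.Disproof

set_option linter.dupNamespace false

open Matrix Literature.MathematicalPhysics.QuantumLattice Literature.Probability.LatticeModels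
open Summit.HubbardSuperconductivity.HubbardSuperconductivity.Theses.DeformationLadder
open Summit.HubbardSuperconductivity.HubbardSuperconductivity.Theorems.DeformationLadder
open Summit.HubbardSuperconductivity.LadderThesis.Negative

/-! ## §A Load-bearing hypotheses -/

/-- `LadderThesis` with the hypothesis `0 < U` dropped to the free point `U = 0` (all other data free). -/
def LadderThesisWithoutHU : Prop :=
  ∃ δ ∈ Set.Ioo (0:ℝ) (1 / 2), ∃ s : ℝ, 0 < s ∧ ∃ a : ℝ, 0 < a ∧ ∃ L₀ : ℕ, ∀ (L : ℕ) [NeZero L],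
    L₀ ≤ L → Even L → ∃ φ : Fock (Orb (FermionTorus 2 L)), star φ ⬝ᵥ φ = 1 ∧
      IsGroundStateInSector (hubbardTorus 2 L 1 0 + ((s / (L : ℝ) ^ 4 : ℝ) : ℂ) •
        ((pairField dWaveFormFactor L)ᴴ * pairField dWaveFormFactor L)) (2 * ⌊(1 - δ) * (L : ℝ) ^ 2 / 2⌋₊) 0 φ ∧
      a ≤ (expect ((pairField dWaveFormFactor L)ᴴ * pairField dWaveFormFactor L) φ).re / (L : ℝ) ^ 4

/-- **Any proof must use `0 < U`**: at the free point the matrix fails for every `δ, s, a, L₀`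
(PF's `not_ladderThesisMatrix_at_free_point`, p91441: free sector ground states have a sharp Fermi step,
pair intensity `≤ 320L²`, and the Kaplan–Horsch–von der Linden comparison transfers the ceiling to every
penalised ground state). [folklore] -/
theorem ladderThesis_false_without_hU : ¬ LadderThesisWithoutHU := by
  rintro ⟨δ, hδ, s, hs, a, ha, L₀, h⟩
  exact not_ladderThesisMatrix_at_free_point δ (by linarith [hδ.1]) hs ha L₀ h

/-- `LadderThesis` with `0 < a` weakened to `0 ≤ a`. -/
def LadderThesisWithoutPosA : Prop :=
  ∃ U : ℝ, 0 < U ∧ ∃ δ ∈ Set.Ioo (0:ℝ) (1 / 2), ∃ s : ℝ, 0 < s ∧ ∃ a : ℝ, 0 ≤ a ∧ ∃ L₀ : ℕ,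
    ∀ (L : ℕ) [NeZero L], L₀ ≤ L → Even L → ∃ φ : Fock (Orb (FermionTorus 2 L)), star φ ⬝ᵥ φ = 1 ∧
      IsGroundStateInSector (hubbardTorus 2 L 1 U + ((s / (L : ℝ) ^ 4 : ℝ) : ℂ) •
        ((pairField dWaveFormFactor L)ᴴ * pairField dWaveFormFactor L)) (2 * ⌊(1 - δ) * (L : ℝ) ^ 2 / 2⌋₊) 0 φ ∧
      a ≤ (expect ((pairField dWaveFormFactor L)ᴴ * pairField dWaveFormFactor L) φ).re / (L : ℝ) ^ 4

/-- **`0 < a` carries all the content**: with `a := 0` the matrix holds at EVERY `U, δ ∈ (0,1/2), s`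
(penalised sector ground states exist, `penalisedGroundStateExists_proof` p88396, and `Δ_dᴴΔ_d ≥ 0`).
So no hypothesis other than the floor can be "mutated away": the crux is exactly the positivity of the
floor. [folklore] -/
theorem ladderThesisWithoutPosA_holds : LadderThesisWithoutPosA := by
  refine ⟨1, one_pos, 1 / 4, ⟨by norm_num, by norm_num⟩, 1, one_pos, 0, le_rfl, 0, fun L _ _ _ => ?_⟩
  have hn : ⌊(1 - (1 / 4 : ℝ)) * (L : ℝ) ^ 2 / 2⌋₊ ≤ L ^ 2 :=
    Summit.HubbardSuperconductivity.NoGo.floor_pairNumber_le (1 / 4) (by norm_num) L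
  obtain ⟨φ, hφ1, hφ⟩ := penalisedGroundStateExists_proof L 1 (1 / (L : ℝ) ^ 4) _ hn
  refine ⟨φ, hφ1, hφ, ?_⟩
  exact div_nonneg (re_expect_pairPenalty_nonneg L φ) (by positivity)

/-- **The penalty strength is rigid upward** (mine, file 2 `floor_mul_sqrt_penalty_le`): every instance
`(U, δ, s, a, L₀)` of the matrix of `LadderThesis` has `a · √s ≤ 32(π² + 1)`. [folklore] -/
theorem ladderThesis_floor_mul_sqrt_penalty_le (U δ : ℝ) {s a : ℝ} (hs : 0 < s) (L₀ : ℕ)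
    (h : ∀ (L : ℕ) [NeZero L], L₀ ≤ L → Even L →
        ∃ φ : Fock (Orb (FermionTorus 2 L)), star φ ⬝ᵥ φ = 1 ∧
          IsGroundStateInSector (hubbardTorus 2 L 1 U + ((s / (L : ℝ) ^ 4 : ℝ) : ℂ) •
            ((pairField dWaveFormFactor L)ᴴ * pairField dWaveFormFactor L))
            (2 * ⌊(1 - δ) * (L : ℝ) ^ 2 / 2⌋₊) 0 φ ∧
          a ≤ (expect ((pairField dWaveFormFactor L)ᴴ * pairField dWaveFormFactor L) φ).re /
            (L : ℝ) ^ 4) :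
    a * Real.sqrt s ≤ 32 * (Real.pi ^ 2 + 1) :=
  floor_mul_sqrt_penalty_le U δ hs L₀ h

/-! ## §B Tightness: the window of the equivalent crux `LowEnergyRigidity` is capped by the floor -/

/-- **`κ · a ≤ 2048π²` for every instance of `LowEnergyRigidity`** (mine, file 2
`window_mul_floor_le_of_lowEnergyRigidityMatrix`; `LadderThesis ↔ LowEnergyRigidity` is p89166). [folklore] -/
theorem lowEnergyRigidity_window_mul_floor_le (U δ : ℝ) (hδ : -1 ≤ δ) {κ a : ℝ} (hκ : 0 ≤ κ) (L₀ : ℕ)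
    (h : ∀ (L : ℕ) [NeZero L], L₀ ≤ L → Even L →
      ∀ φ : Fock (Orb (FermionTorus 2 L)), φ ∈ szSector (2 * ⌊(1 - δ) * (L : ℝ) ^ 2 / 2⌋₊) 0 →
        star φ ⬝ᵥ φ = 1 →
          (star φ ⬝ᵥ Matrix.mulVec (hubbardTorus 2 L 1 U) φ).re ≤
            (hubbardTorus 2 L 1 U).minEnergyOn (szSector (2 * ⌊(1 - δ) * (L : ℝ) ^ 2 / 2⌋₊) 0) + κ →
          a ≤ (expect ((pairField dWaveFormFactor L)ᴴ * pairField dWaveFormFactor L) φ).re / (L : ℝ) ^ 4) :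
    κ * a ≤ 2048 * Real.pi ^ 2 :=
  window_mul_floor_le_of_lowEnergyRigidityMatrix U δ hδ hκ L₀ h

/-! ## §C Natural strengthenings, refuted -/

/-- `LadderThesis` with the floor `a` UNIFORM in the penalty strength (`∃ s` moved inside, universal). -/
def LadderThesisUniformInPenalty : Prop :=
  ∃ U : ℝ, 0 < U ∧ ∃ δ ∈ Set.Ioo (0:ℝ) (1 / 2), ∃ a : ℝ, 0 < a ∧ ∃ L₀ : ℕ, ∀ s : ℝ, 0 < s →
    ∀ (L : ℕ) [NeZero L], L₀ ≤ L → Even L →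
      ∃ φ : Fock (Orb (FermionTorus 2 L)), star φ ⬝ᵥ φ = 1 ∧
        IsGroundStateInSector (hubbardTorus 2 L 1 U + ((s / (L : ℝ) ^ 4 : ℝ) : ℂ) •
          ((pairField dWaveFormFactor L)ᴴ * pairField dWaveFormFactor L))
          (2 * ⌊(1 - δ) * (L : ℝ) ^ 2 / 2⌋₊) 0 φ ∧
        a ≤ (expect ((pairField dWaveFormFactor L)ᴴ * pairField dWaveFormFactor L) φ).re / (L : ℝ) ^ 4

/-- **Refuted strengthening 1**: the floor cannot be uniform in the penalty strength (frame-averaged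
ceiling at `s = (64(π²+1)/a)²`; mine, file 2). [folklore] -/
theorem not_ladderThesisUniformInPenalty : ¬ LadderThesisUniformInPenalty :=
  not_ladderThesis_uniform_in_penalty

/-- `LowEnergyRigidity` (≡ the crux) with the floor `a` UNIFORM in the window `κ`. -/
def LowEnergyRigidityUniformInWindow : Prop :=
  ∃ U : ℝ, 0 < U ∧ ∃ δ ∈ Set.Ioo (0:ℝ) (1 / 2), ∃ a : ℝ, 0 < a ∧ ∀ κ : ℝ, 0 < κ → ∃ L₀ : ℕ,
    ∀ (L : ℕ) [NeZero L], L₀ ≤ L → Even L →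
      ∀ φ : Fock (Orb (FermionTorus 2 L)), φ ∈ szSector (2 * ⌊(1 - δ) * (L : ℝ) ^ 2 / 2⌋₊) 0 →
        star φ ⬝ᵥ φ = 1 →
          (star φ ⬝ᵥ Matrix.mulVec (hubbardTorus 2 L 1 U) φ).re ≤
            (hubbardTorus 2 L 1 U).minEnergyOn (szSector (2 * ⌊(1 - δ) * (L : ℝ) ^ 2 / 2⌋₊) 0) + κ →
          a ≤ (expect ((pairField dWaveFormFactor L)ᴴ * pairField dWaveFormFactor L) φ).re / (L : ℝ) ^ 4

/-- **Refuted strengthening 2**: the rigidity floor cannot be uniform in the window (even with `L₀`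
allowed to depend on `κ`): at `κ = 2048π²/a + 1` the bound `κ·a ≤ 2048π²` fails. [folklore] -/
theorem not_lowEnergyRigidityUniformInWindow : ¬ LowEnergyRigidityUniformInWindow := by
  rintro ⟨U, -, δ, hδ, a, ha, h⟩
  set κ : ℝ := 2048 * Real.pi ^ 2 / a + 1 with hκ
  have hκ0 : 0 < κ := by rw [hκ]; positivity
  obtain ⟨L₀, hL⟩ := h κ hκ0
  have hb := lowEnergyRigidity_window_mul_floor_le U δ (by linarith [hδ.1]) hκ0.le L₀ hL
  have e : κ * a = 2048 * Real.pi ^ 2 + a := by rw [hκ]; field_simp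
  linarith

/-! ## §D Targets — none live (line `Sketch` dead; see the module docstring) -/

/-! ## §E Resistance, as the two implications the tree holds by name -/

/-- The crux implies the summit (the route's `Assembly`, proved): a kill of the crux that is not a kill of
S must exhibit LRO WITHOUT LRO-stiffness at the witness `(U, δ)`. [folklore] -/
theorem crux_implies_summit (hA : Assembly) (hX : LadderThesis) : _root_.HubbardSuperconductivity := hA hX

/-- The crux is its own "rigidity" normal form (p89166): any disproof is a disproof of O(1)-window
phase rigidity of the pure model at EVERY `(U, δ)`. [folklore] -/
theorem crux_iff_rigidity : LadderThesis ↔ LowEnergyRigidity := ladderThesis_iff_lowEnergyRigidity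

/-! ## §F Normal-form remark for provers: "some ground state" = "every ground state" up to `s ↦ s/2` -/

/-- **`∃ φ` and `∀ φ` versions of the crux are equivalent** (slope monotonicity, PF's
`re_expect_pairPenalty_anti`, p91441): if SOME unit sector ground state at penalty `s` has LRO `≥ a`,
then EVERY unit sector ground state at every weaker penalty `s' < s` has LRO `≥ a`; conversely ground
states exist (p88396). So a prover may aim at either form; a disprover gains nothing from degeneracy. [folklore] -/
theorem ladderThesis_iff_everyGroundState :
    LadderThesis ↔
      ∃ U : ℝ, 0 < U ∧ ∃ δ ∈ Set.Ioo (0:ℝ) (1 / 2), ∃ s : ℝ, 0 < s ∧ ∃ a : ℝ, 0 < a ∧ ∃ L₀ : ℕ,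
        ∀ (L : ℕ) [NeZero L], L₀ ≤ L → Even L →
          ∀ φ : Fock (Orb (FermionTorus 2 L)), star φ ⬝ᵥ φ = 1 →
            IsGroundStateInSector (hubbardTorus 2 L 1 U + ((s / (L : ℝ) ^ 4 : ℝ) : ℂ) •
              ((pairField dWaveFormFactor L)ᴴ * pairField dWaveFormFactor L))
              (2 * ⌊(1 - δ) * (L : ℝ) ^ 2 / 2⌋₊) 0 φ →
            a ≤ (expect ((pairField dWaveFormFactor L)ᴴ * pairField dWaveFormFactor L) φ).re /
              (L : ℝ) ^ 4 := by
  constructor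
  · rintro ⟨U, hU, δ, hδ, s, hs, a, ha, L₀, h⟩
    refine ⟨U, hU, δ, hδ, s / 2, by positivity, a, ha, L₀, fun L _ hL hE φ' hφ'1 hφ' => ?_⟩
    obtain ⟨φ, hφ1, hφ, hφa⟩ := h L hL hE
    refine hφa.trans (div_le_div_of_nonneg_right ?_ (by positivity))
    exact re_expect_pairPenalty_anti L U (by linarith) _ hφ1 hφ'1 hφ hφ'
  · rintro ⟨U, hU, δ, hδ, s, hs, a, ha, L₀, h⟩
    refine ⟨U, hU, δ, hδ, s, hs, a, ha, L₀, fun L _ hL hE => ?_⟩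
    have hn := Summit.HubbardSuperconductivity.NoGo.floor_pairNumber_le δ (by linarith [hδ.1]) L
    obtain ⟨φ, hφ1, hφ⟩ := penalisedGroundStateExists_proof L U (s / (L : ℝ) ^ 4) _ hn
    exact ⟨φ, hφ1, hφ, h L hL hE φ hφ1 hφ⟩

end Summit.HubbardSuperconductivity.HubbardSuperconductivity.Cruxes.LadderThesis.Disproof
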